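import Summits.QuantumFields.YangMills.Theorems.PoincareLipschitzHierAlignT3
import HarnessLib

/-!
# Crux stmt-QuantumFields-19936 `HistoryTailL` — THE HIERARCHICAL ALIGNMENT AT THE CRUX'S WINDOWS, AT EVERY LEVEL OF THE TOWER («ALIGN-T3-LEVEL»):
# under hStab's windows around `a`, for EVERY height `i ≤ j+1` ONE gauge of `T^{(i)}` makes every bond of `Ū^i(U)` within `8L^{j+1} + 3(L^i−1)` of `a`
# close to `1` — `dist1 (((Ū^i U)^{u_i}) c) ≤ 50L²·Σ_{i≤i'<j+1} θBal(K−i') + 6644L²·θBal(K−j)` — and the two-field ∕ uniform forms at level `i`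

Cell `ym3-torus` (YM ladder rung R3 = continuum SU(2) Yang–Mills on the three-torus — a RUNG, NOT the Clay problem; not d = 4, not
infinite volume, not a mass gap), width seat `ym-ust-19936-w3` gen 12, `--supports stmt-QuantumFields-19936 --as helper`.  LEAD ★w1-19936 g7
word 01:07:50Z «ALIGN GO»; card v1.30 «deep regime = COVARIANT CAMPANATO ROAD + ALIGN».  ✓`PoincareLipschitzHierAlignT3` gives the sup-chart at
level `0`; the re-gauged tower of the K2 supplier plan (F5 ✓p686808 ∕ F6) reads the pair `(Ū^i U, Ū^i U')` at EVERY height `i ≤ j`, and a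
sup-chart there is NOT inherited from level `0` (one-step averaging is sup-Lipschitz only with a factor `≍ L`, which iterates).  THIS FILE proves
the chart DIRECTLY AT EACH LEVEL by the downward induction of Bałaban's hierarchical axial gauge [Balaban1985Averaging] §C (64)–(68): the gauge of
`T^{(i)}` is the block-axial gauge of `Ū^i U` ROOTED in the gauge of `T^{(i+1)}` (✓`PoincareLipschitzHierAlignStep.exists_rootedBlockAxialGauge_SU`),
the top gauge being the torus axial gauge of `Ū^{j+1}(U)` on the `23`-cube around `a₋`; the regions grow by `3(L−1)L^i` per level
(`8L^{j+1} + 3(L^i − 1)` at height `i`), so that the block of a level-`i` bond in the region is in the level-`(i+1)` region.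

* ★★★ `exists_hierGauge_dist1_le_of_windows_level` — single field, every height `i ≤ j + 1`;
* ★★ `exists_relGauge_dist1_le_of_windows_level` — two fields: ONE gauge `g_i` of `T^{(i)}` with
  `dist1 (((Ū^i U')^{g_i}) c · ((Ū^i U) c)⁻¹) ≤ 2·(50L²·Σ_{i≤i'<j+1} θBal(K−i') + 6644L²·θBal(K−j))` on the level-`i` region;
* ★★★ `exists_gamma_relGauge_dist1_le_level` — THE UNIFORM FORM: for every `L ≥ 2`, `b₀ > 0`, `p₀ > 0`, `τ > 0` one `γ₁` such that for `γ ≤ γ₁`, every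
  member, every `K`, every `j` with `j + 3 ≤ K` and EVERY height `i ≤ j + 1`, two hierarchically-small configurations around `a` are within `τ` of each
  other bondwise at level `i` after one gauge, on the whole level-`i` region.

THEOREMS ONLY, def-free; nothing of h⋆, F5∕F6, `BlockLipschitzL`, the stubs of any registered line, the crux `HistoryTailL` or a summit statement
is proved here.
-/

noncomputable section

open scoped BigOperators

namespace Summit.QuantumFields.YangMills.Theorems.PoincareLipschitzHierAlignT3Level

open Literature.MathematicalPhysics.QuantumFieldTheory.Balaban1983to89
open Literature.MathematicalPhysics.QuantumFieldTheory.Balaban1983to89.T3ContinuumYM3Torus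
open Literature.MathematicalPhysics.QuantumFieldTheory.Balaban1983to89.T3UnitLawDensityEML
open T4Continuum BlockAveraging ExpMeanLog T3UnitScaleTilt
open Literature.MathematicalPhysics.QuantumFieldTheory.Balaban1983to89.B3Taylor310LocalRemainder (tdist_triangle tdist_comm tdist_self)
open Summit.QuantumFields.YangMills.Theorems.PoincareLipschitzHierAlignStep (exists_rootedBlockAxialGauge_SU)
open Summit.QuantumFields.YangMills.Theorems.PoincareLipschitzHierAlignTower (dist1_relGauge_le)
open Summit.QuantumFields.YangMills.Theorems.PoincareLipschitzHierAlignT3Geometry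
open Summit.QuantumFields.YangMills.Theorems.PoincareLipschitzHierAlignT3 (twentytwo_lt_sitesPerDir_succ guard_lt_deltaSU sum_range_θBal_eq_sum_image)
open T4AxialGaugeSmallField (castSite castSite_apply boxPlaqs axialGauge dist1_gaugeAct_axialGauge_le_uniform)
open B7Prop1Explicit (e e_apply)

variable {F : T3Family} {K j : ℕ} {γ b₀ p₀ : ℝ}

/-- The downward induction behind `exists_hierGauge_dist1_le_of_windows_level`: `N` levels below the top `j + 1 = i + N`. [cite: Balaban1985Averaging, (64)-(68) p.29] -/
theorem exists_hierGauge_level_aux (hjK : j + 3 ≤ K) (hγ : 0 < γ) (hγ1 : γ ≤ 1) (hb : 0 < b₀)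
    (hθσ : ∀ i, i ≤ j → θBal F.L γ b₀ p₀ (K - i) ≤ 1 / (75 * ((F.L : ℝ) + 1) ^ 2))
    (a : Plaq (F.P K) (j + 1)) (U : GaugeField (F.P K) 0 (Matrix.specialUnitaryGroup (Fin 2) ℂ))
    (hU : (∀ (i : ℕ) (q : Plaq (F.P K) i), i < j + 1 → Site.tdist (fun k => ((((q.src k).val * F.L ^ i : ℕ)) : ZMod ((F.P K).sitesPerDir 0))) (fun k => ((((a.src k).val * F.L ^ (j + 1) : ℕ)) : ZMod ((F.P K).sitesPerDir 0))) + 64 * F.L ^ i ≤ 64 * F.L ^ (j + 1) → GaugeGroup.dist1 (GaugeField.plaqHol (Averaging.iter (fun i' => BlockAveraging.blockAvg (P := F.P K) (j := i') T3UnitLawDensityEML.ℰp) i U) q) < T3UnitScaleTilt.θBal F.L γ b₀ p₀ (K - i))) :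
    ∀ (N i : ℕ), i + N = j + 1 →
      ∃ u : GaugeTransf (F.P K) i (Matrix.specialUnitaryGroup (Fin 2) ℂ), ∀ c : PBond (F.P K) i,
        Site.tdist (fun k => ((((c.src k).val * F.L ^ i : ℕ)) : ZMod ((F.P K).sitesPerDir 0)))
            (fun k => ((((a.src k).val * F.L ^ (j + 1) : ℕ)) : ZMod ((F.P K).sitesPerDir 0))) ≤ 8 * F.L ^ (j + 1) + 3 * (F.L ^ i - 1) →
        dist1 (GaugeField.gaugeAct u (Averaging.iter (fun i' => BlockAveraging.blockAvg (P := F.P K) (j := i') T3UnitLawDensityEML.ℰp) i U) c) ≤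
          50 * (F.L : ℝ) ^ 2 * (∑ i' ∈ Finset.Ico i (j + 1), θBal F.L γ b₀ p₀ (K - i')) + 6644 * (F.L : ℝ) ^ 2 * θBal F.L γ b₀ p₀ (K - j) := by
  have hL3 : 3 ≤ F.L := (by obtain ⟨k, hk⟩ := F.hL.1; have := F.hL.2; omega)
  have hm := F.hm
  have hd : (F.P K).d = 3 := rfl
  have hj1 : j + 1 ≤ (F.P K).m + (F.P K).K := by show j + 1 ≤ F.m + K; omega
  have hθ0 : ∀ i, 0 ≤ θBal F.L γ b₀ p₀ (K - i) := fun i =>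
    (T3MinimiserStabilityReduction.θBal_pos (by omega) hγ hγ1 hb p₀ (K - i)).le
  intro N
  induction N with
  | zero =>
    /- the TOP: the torus axial gauge of `Ū^{j+1}(U)` on the `23`-cube around `a₋` -/
    intro i hi
    rw [Nat.add_zero] at hi
    subst hi
    set V : GaugeField (F.P K) (j + 1) (Matrix.specialUnitaryGroup (Fin 2) ℂ) :=
      Averaging.iter (fun i' => BlockAveraging.blockAvg (P := F.P K) (j := i') T3UnitLawDensityEML.ℰp) (j + 1) U with hV
    have hVavg : V = avgFun (expMeanLogSU (n := Fin 2))
        (Averaging.iter (fun i' => BlockAveraging.blockAvg (P := F.P K) (j := i') T3UnitLawDensityEML.ℰp) j U) := rfl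
    let A : Fin (F.P K).d → ℤ := fun k => ((a.src k).val : ℤ)
    have hA : a.src = (castSite A : Site (F.P K) (j + 1)) := by
      funext k; rw [castSite_apply]; show a.src k = (((((a.src k).val : ℕ) : ℤ)) : ZMod _); rw [Int.cast_natCast, ZMod.natCast_zmod_val]
    let lo : Fin (F.P K).d → ℤ := fun k => A k - 11
    let hi : Fin (F.P K).d → ℤ := fun k => A k + 11
    have hn : ∀ κ, hi κ ≤ lo κ + (22 : ℕ) := fun κ => by show A κ + 11 ≤ A κ - 11 + ((22 : ℕ) : ℤ); push_cast; omega
    have hnN : 22 < (F.P K).sitesPerDir (j + 1) := twentytwo_lt_sitesPerDir_succ (F := F) hjK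
    have htop : PlaqSmallOn (boxPlaqs lo hi) (((F.L : ℝ) ^ 2 + 6 * (((5 * F.L : ℕ)) : ℝ) ^ 2) * θBal F.L γ b₀ p₀ (K - j)) V := by
      intro p hp
      obtain ⟨z, hzlo, hzhi, hsrc⟩ := hp
      have hpz : Site.tdist p.src a.src ≤ 33 := by
        have ez : z = A + (z - A) := by abel
        rw [hsrc, hA, ez]
        refine (tdist_castSite_add_le A (z - A)).trans ?_
        calc ∑ k, ((z - A) k).natAbs ≤ ∑ _k : Fin (F.P K).d, 11 := Finset.sum_le_sum fun k _ => by
                have h1 : A k - 11 ≤ z k := hzlo k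
                have h2 : z k + e p.μ k + e p.ν k ≤ A k + 11 := hzhi k
                rw [e_apply, e_apply] at h2
                show (z k - A k).natAbs ≤ 11
                split_ifs at h2 <;> omega
          _ = 33 := by rw [Finset.sum_const, Finset.card_univ, Fintype.card_fin, hd, smul_eq_mul]
      have key := BlockAveragingPlaquetteBoundLocal.dist1_plaqHol_avgFun_lt_of_near (n := Fin 2) hj1 (hθ0 j)
        (U := Averaging.iter (fun i' => BlockAveraging.blockAvg (P := F.P K) (j := i') T3UnitLawDensityEML.ℰp) j U) p
        (fun q hq => hU j q (by omega) (by
          have h1 : Site.tdist (blockOf q.src) a.src ≤ 36 :=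
            (tdist_triangle _ p.src _).trans (by have := tdist_le_three_of_near (blockOf q.src) p.src hq; omega)
          have h2 : Site.tdist (fun k => ((((q.src k).val * F.L ^ j : ℕ)) : ZMod ((F.P K).sitesPerDir 0)))
              (fun k => ((((blockOf q.src k).val * F.L ^ (j + 1) : ℕ)) : ZMod ((F.P K).sitesPerDir 0))) ≤ 3 * F.L ^ (j + 1) := by
            refine (tdist_scaled_blockOf_le (F := F) (K := K) hj1 q.src).trans ?_
            rw [pow_succ, mul_comm (F.L ^ j)]
            exact Nat.mul_le_mul_left _ (Nat.mul_le_mul_right _ (Nat.sub_le _ _))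
          have h3 : Site.tdist (fun k => ((((blockOf q.src k).val * F.L ^ (j + 1) : ℕ)) : ZMod ((F.P K).sitesPerDir 0)))
              (fun k => ((((a.src k).val * F.L ^ (j + 1) : ℕ)) : ZMod ((F.P K).sitesPerDir 0))) ≤ 36 * F.L ^ (j + 1) := by
            rw [tdist_scaled_eq (F := F) (K := K) hj1 (blockOf q.src) a.src, mul_comm]
            exact Nat.mul_le_mul_right _ h1
          have h4 := tdist_triangle (fun k => ((((q.src k).val * F.L ^ j : ℕ)) : ZMod ((F.P K).sitesPerDir 0)))
            (fun k => ((((blockOf q.src k).val * F.L ^ (j + 1) : ℕ)) : ZMod ((F.P K).sitesPerDir 0)))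
            (fun k => ((((a.src k).val * F.L ^ (j + 1) : ℕ)) : ZMod ((F.P K).sitesPerDir 0)))
          have hp2 : 3 * F.L ^ j ≤ F.L ^ (j + 1) := by rw [pow_succ, mul_comm]; exact Nat.mul_le_mul_left _ hL3
          omega))
        (guard_lt_deltaSU (hθσ j le_rfl))
      have e5 : ((((F.P K).d + 2) * (F.P K).L : ℕ) : ℝ) = (((5 * F.L : ℕ)) : ℝ) := by
        show ((((3 + 2) * F.L : ℕ)) : ℝ) = (((5 * F.L : ℕ)) : ℝ); norm_num
      have eL : ((F.P K).L : ℝ) = F.L := rfl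
      rw [← hVavg, e5, eL] at key
      exact key
    have hδtop : 0 ≤ ((F.L : ℝ) ^ 2 + 6 * (((5 * F.L : ℕ)) : ℝ) ^ 2) * θBal F.L γ b₀ p₀ (K - j) := by have := hθ0 j; positivity
    refine ⟨axialGauge V lo hi, fun c hc => ?_⟩
    -- the bond `c` is within torus distance `10` of `a₋`
    have hct : Site.tdist c.src a.src ≤ 10 := by
      have h2 := tdist_scaled_eq (F := F) (K := K) hj1 c.src a.src
      have hLj1 : 1 ≤ F.L ^ (j + 1) := Nat.one_le_pow _ _ (by omega)
      have hlt : F.L ^ (j + 1) * Site.tdist c.src a.src < F.L ^ (j + 1) * 11 := by rw [← h2]; omega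
      have := Nat.lt_of_mul_lt_mul_left hlt
      omega
    obtain ⟨x, hxy, hxA⟩ := exists_int_rep_of_tdist_le c.src a.src A hA hct
    have hxlo : lo ≤ x := fun k => by show A k - 11 ≤ x k; have := (hxA k).1; push_cast at this; omega
    have hxhi : x + e c.dir ≤ hi := fun k => by
      show x k + e c.dir k ≤ A k + 11
      have := (hxA k).2; push_cast at this
      rw [e_apply]; split_ifs <;> omega
    have htopbond := dist1_gaugeAct_axialGauge_le_uniform V (subset_refl _) htop hδtop hn hnN hxlo hxhi
    have ec : (⟨castSite x, c.dir⟩ : PBond (F.P K) (j + 1)) = c := by rw [hxy]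
    rw [ec] at htopbond
    have hbd : ((((F.P K).d - 1 : ℕ)) : ℝ) = 2 := by rw [hd]; norm_num
    rw [hbd] at htopbond
    have etop : 2 * (22 : ℕ) * (((F.L : ℝ) ^ 2 + 6 * (((5 * F.L : ℕ)) : ℝ) ^ 2) * θBal F.L γ b₀ p₀ (K - j)) =
        6644 * (F.L : ℝ) ^ 2 * θBal F.L γ b₀ p₀ (K - j) := by push_cast; ring
    rw [etop] at htopbond
    rw [Finset.Ico_self, Finset.sum_empty, mul_zero, zero_add]
    exact htopbond
  | succ N ih =>
    /- one level down: the block-axial gauge of `Ū^i U` rooted in the gauge of `T^{(i+1)}` -/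
    intro i hi
    have hij : i ≤ j := by omega
    have hi1 : i + 1 ≤ (F.P K).m + (F.P K).K := by show i + 1 ≤ F.m + K; omega
    obtain ⟨h, hh⟩ := ih (i + 1) (by omega)
    obtain ⟨u, -, hstep⟩ := exists_rootedBlockAxialGauge_SU (n := Fin 2) (j := i) hi1
      (Averaging.iter (fun i' => BlockAveraging.blockAvg (P := F.P K) (j := i') T3UnitLawDensityEML.ℰp) i U) h
    refine ⟨u, fun c hc => ?_⟩
    -- powers of `L`
    have hp1 : F.L ^ (i + 1) ≤ F.L ^ (j + 1) := Nat.pow_le_pow_right (by omega) (by omega)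
    have hp2 : 3 * F.L ^ i ≤ F.L ^ (i + 1) := by rw [pow_succ, mul_comm]; exact Nat.mul_le_mul_left _ hL3
    have hLi : 1 ≤ F.L ^ i := Nat.one_le_pow _ _ (by omega)
    have hblk : ∀ x : Site (F.P K) i, Site.tdist (fun k => ((((x k).val * F.L ^ i : ℕ)) : ZMod ((F.P K).sitesPerDir 0)))
        (fun k => ((((blockOf x k).val * F.L ^ (i + 1) : ℕ)) : ZMod ((F.P K).sitesPerDir 0))) ≤ 3 * F.L ^ (i + 1) - 3 * F.L ^ i := by
      intro x
      refine (tdist_scaled_blockOf_le (F := F) (K := K) hi1 x).trans ?_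
      have e1 : (F.L - 1) * F.L ^ i + F.L ^ i = F.L ^ (i + 1) := by
        have h : F.L - 1 + 1 = F.L := by omega
        calc (F.L - 1) * F.L ^ i + F.L ^ i = (F.L - 1 + 1) * F.L ^ i := by ring
          _ = F.L ^ (i + 1) := by rw [h, pow_succ, mul_comm]
      omega
    -- the one-level estimate at `c`
    have h2 := hstep c (θBal F.L γ b₀ p₀ (K - i)) (hθ0 i) (fun q hq => hU i q (by omega) (by
        rw [hd] at hq
        have g1 := hblk q.src
        have g2 : Site.tdist (fun k => ((((blockOf q.src k).val * F.L ^ (i + 1) : ℕ)) : ZMod ((F.P K).sitesPerDir 0)))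
            (fun k => ((((blockOf c.src k).val * F.L ^ (i + 1) : ℕ)) : ZMod ((F.P K).sitesPerDir 0))) ≤ 6 * F.L ^ (i + 1) := by
          rw [tdist_scaled_eq (F := F) (K := K) hi1 (blockOf q.src) (blockOf c.src), mul_comm]
          exact Nat.mul_le_mul_right _ hq
        have g3 := hblk c.src
        rw [tdist_comm] at g3
        have g4 := tdist_triangle (fun k => ((((q.src k).val * F.L ^ i : ℕ)) : ZMod ((F.P K).sitesPerDir 0)))
          (fun k => ((((blockOf q.src k).val * F.L ^ (i + 1) : ℕ)) : ZMod ((F.P K).sitesPerDir 0)))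
          (fun k => ((((a.src k).val * F.L ^ (j + 1) : ℕ)) : ZMod ((F.P K).sitesPerDir 0)))
        have g5 := tdist_triangle (fun k => ((((blockOf q.src k).val * F.L ^ (i + 1) : ℕ)) : ZMod ((F.P K).sitesPerDir 0)))
          (fun k => ((((blockOf c.src k).val * F.L ^ (i + 1) : ℕ)) : ZMod ((F.P K).sitesPerDir 0)))
          (fun k => ((((a.src k).val * F.L ^ (j + 1) : ℕ)) : ZMod ((F.P K).sitesPerDir 0)))
        have g6 := tdist_triangle (fun k => ((((blockOf c.src k).val * F.L ^ (i + 1) : ℕ)) : ZMod ((F.P K).sitesPerDir 0)))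
          (fun k => ((((c.src k).val * F.L ^ i : ℕ)) : ZMod ((F.P K).sitesPerDir 0)))
          (fun k => ((((a.src k).val * F.L ^ (j + 1) : ℕ)) : ZMod ((F.P K).sitesPerDir 0)))
        omega))
      (guard_lt_deltaSU (hθσ i hij))
    -- the coarse bond `⟨blockOf c₋, dir c⟩` is in the level-`(i+1)` region
    have h1 := hh ⟨blockOf c.src, c.dir⟩ (by
      have g3 := hblk c.src
      rw [tdist_comm] at g3
      have g6 := tdist_triangle (fun k => ((((blockOf c.src k).val * F.L ^ (i + 1) : ℕ)) : ZMod ((F.P K).sitesPerDir 0)))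
        (fun k => ((((c.src k).val * F.L ^ i : ℕ)) : ZMod ((F.P K).sitesPerDir 0)))
        (fun k => ((((a.src k).val * F.L ^ (j + 1) : ℕ)) : ZMod ((F.P K).sitesPerDir 0)))
      have hLi1 : 1 ≤ F.L ^ (i + 1) := Nat.one_le_pow _ _ (by omega)
      show Site.tdist (fun k => ((((blockOf c.src k).val * F.L ^ (i + 1) : ℕ)) : ZMod ((F.P K).sitesPerDir 0))) _ ≤ _
      omega)
    have e : Averaging.iter (fun i' => BlockAveraging.blockAvg (P := F.P K) (j := i') T3UnitLawDensityEML.ℰp) (i + 1) U =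
        avgFun (expMeanLogSU (n := Fin 2))
          (Averaging.iter (fun i' => BlockAveraging.blockAvg (P := F.P K) (j := i') T3UnitLawDensityEML.ℰp) i U) := rfl
    rw [e] at h1
    have e5 : ((((F.P K).d + 2) * (F.P K).L : ℕ) : ℝ) = 5 * (F.L : ℝ) := by
      show ((((3 + 2) * F.L : ℕ)) : ℝ) = 5 * (F.L : ℝ); push_cast; ring
    rw [e5] at h2
    rw [Finset.sum_eq_sum_Ico_succ_bot (by omega : i < j + 1), mul_add]
    have e50 : 2 * ((5 * (F.L : ℝ)) ^ 2) = 50 * (F.L : ℝ) ^ 2 := by ring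
    rw [e50] at h2
    linarith

/-- ★★★ **THE HIERARCHICAL GAUGE AT THE CRUX'S WINDOWS, AT EVERY LEVEL.**  Let `j + 3 ≤ K`, `0 < γ ≤ 1`, `0 < b₀`, the thresholds
`θBal(K−i') ≤ 1∕(75(L+1)²)` for `i' ≤ j`, and let `U` satisfy hStab's hierarchical windows around the level-`(j+1)` plaquette `a`.  Then for every
height `i ≤ j + 1` ONE gauge `u` of `T^{(i)}` makes every level-`i` bond `c` of the `i`-fold average with scaled corner within
`8L^{j+1} + 3(L^i − 1)` of `a₋·L^{j+1}` satisfy `dist1 (((Ū^i U)^u) c) ≤ 50·L²·Σ_{i≤i'<j+1} θBal(K−i') + 6644·L²·θBal(K−j)`.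
[cite: Balaban1985Averaging, (64)-(68) p.29; Balaban1987RG1, (0.3)-(0.4) pp.252-253] -/
theorem exists_hierGauge_dist1_le_of_windows_level (hjK : j + 3 ≤ K) (hγ : 0 < γ) (hγ1 : γ ≤ 1) (hb : 0 < b₀)
    (hθσ : ∀ i, i ≤ j → θBal F.L γ b₀ p₀ (K - i) ≤ 1 / (75 * ((F.L : ℝ) + 1) ^ 2))
    (a : Plaq (F.P K) (j + 1)) (U : GaugeField (F.P K) 0 (Matrix.specialUnitaryGroup (Fin 2) ℂ))
    (hU : (∀ (i : ℕ) (q : Plaq (F.P K) i), i < j + 1 → Site.tdist (fun k => ((((q.src k).val * F.L ^ i : ℕ)) : ZMod ((F.P K).sitesPerDir 0))) (fun k => ((((a.src k).val * F.L ^ (j + 1) : ℕ)) : ZMod ((F.P K).sitesPerDir 0))) + 64 * F.L ^ i ≤ 64 * F.L ^ (j + 1) → GaugeGroup.dist1 (GaugeField.plaqHol (Averaging.iter (fun i' => BlockAveraging.blockAvg (P := F.P K) (j := i') T3UnitLawDensityEML.ℰp) i U) q) < T3UnitScaleTilt.θBal F.L γ b₀ p₀ (K - i)))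
    (i : ℕ) (hi : i ≤ j + 1) :
    ∃ u : GaugeTransf (F.P K) i (Matrix.specialUnitaryGroup (Fin 2) ℂ), ∀ c : PBond (F.P K) i,
      Site.tdist (fun k => ((((c.src k).val * F.L ^ i : ℕ)) : ZMod ((F.P K).sitesPerDir 0)))
          (fun k => ((((a.src k).val * F.L ^ (j + 1) : ℕ)) : ZMod ((F.P K).sitesPerDir 0))) ≤ 8 * F.L ^ (j + 1) + 3 * (F.L ^ i - 1) →
      dist1 (GaugeField.gaugeAct u (Averaging.iter (fun i' => BlockAveraging.blockAvg (P := F.P K) (j := i') T3UnitLawDensityEML.ℰp) i U) c) ≤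
        50 * (F.L : ℝ) ^ 2 * (∑ i' ∈ Finset.Ico i (j + 1), θBal F.L γ b₀ p₀ (K - i')) + 6644 * (F.L : ℝ) ^ 2 * θBal F.L γ b₀ p₀ (K - j) :=
  exists_hierGauge_level_aux hjK hγ hγ1 hb hθσ a U hU (j + 1 - i) i (by omega)

/-- ★★ **THE TWO-FIELD SUP-CHART AT EVERY LEVEL**: under the same hypotheses for two configurations `U, U'`, for every height `i ≤ j + 1` ONE gauge
`g` of `T^{(i)}` gives `dist1 (((Ū^i U')^g) c · ((Ū^i U) c)⁻¹) ≤ 2·(50L²·Σ_{i≤i'<j+1} θBal(K−i') + 6644L²·θBal(K−j))` on every level-`i` bond with scaled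
corner within `8L^{j+1} + 3(L^i − 1)` of `a₋·L^{j+1}`. [cite: Balaban1985Averaging, (64)-(68) p.29] -/
theorem exists_relGauge_dist1_le_of_windows_level (hjK : j + 3 ≤ K) (hγ : 0 < γ) (hγ1 : γ ≤ 1) (hb : 0 < b₀)
    (hθσ : ∀ i, i ≤ j → θBal F.L γ b₀ p₀ (K - i) ≤ 1 / (75 * ((F.L : ℝ) + 1) ^ 2))
    (a : Plaq (F.P K) (j + 1)) (U U' : GaugeField (F.P K) 0 (Matrix.specialUnitaryGroup (Fin 2) ℂ))
    (hU : (∀ (i : ℕ) (q : Plaq (F.P K) i), i < j + 1 → Site.tdist (fun k => ((((q.src k).val * F.L ^ i : ℕ)) : ZMod ((F.P K).sitesPerDir 0))) (fun k => ((((a.src k).val * F.L ^ (j + 1) : ℕ)) : ZMod ((F.P K).sitesPerDir 0))) + 64 * F.L ^ i ≤ 64 * F.L ^ (j + 1) → GaugeGroup.dist1 (GaugeField.plaqHol (Averaging.iter (fun i' => BlockAveraging.blockAvg (P := F.P K) (j := i') T3UnitLawDensityEML.ℰp) i U) q) < T3UnitScaleTilt.θBal F.L γ b₀ p₀ (K -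 i)))
    (hU' : (∀ (i : ℕ) (q : Plaq (F.P K) i), i < j + 1 → Site.tdist (fun k => ((((q.src k).val * F.L ^ i : ℕ)) : ZMod ((F.P K).sitesPerDir 0))) (fun k => ((((a.src k).val * F.L ^ (j + 1) : ℕ)) : ZMod ((F.P K).sitesPerDir 0))) + 64 * F.L ^ i ≤ 64 * F.L ^ (j + 1) → GaugeGroup.dist1 (GaugeField.plaqHol (Averaging.iter (fun i' => BlockAveraging.blockAvg (P := F.P K) (j := i') T3UnitLawDensityEML.ℰp) i U') q) < T3UnitScaleTilt.θBal F.L γ b₀ p₀ (K - i)))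
    (i : ℕ) (hi : i ≤ j + 1) :
    ∃ g : GaugeTransf (F.P K) i (Matrix.specialUnitaryGroup (Fin 2) ℂ), ∀ c : PBond (F.P K) i,
      Site.tdist (fun k => ((((c.src k).val * F.L ^ i : ℕ)) : ZMod ((F.P K).sitesPerDir 0)))
          (fun k => ((((a.src k).val * F.L ^ (j + 1) : ℕ)) : ZMod ((F.P K).sitesPerDir 0))) ≤ 8 * F.L ^ (j + 1) + 3 * (F.L ^ i - 1) →
      dist1 (GaugeField.gaugeAct g (Averaging.iter (fun i' => BlockAveraging.blockAvg (P := F.P K) (j := i') T3UnitLawDensityEML.ℰp) i U') c *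
          (Averaging.iter (fun i' => BlockAveraging.blockAvg (P := F.P K) (j := i') T3UnitLawDensityEML.ℰp) i U c)⁻¹) ≤
        2 * (50 * (F.L : ℝ) ^ 2 * (∑ i' ∈ Finset.Ico i (j + 1), θBal F.L γ b₀ p₀ (K - i')) + 6644 * (F.L : ℝ) ^ 2 * θBal F.L γ b₀ p₀ (K - j)) := by
  obtain ⟨u, hu⟩ := exists_hierGauge_dist1_le_of_windows_level hjK hγ hγ1 hb hθσ a U hU i hi
  obtain ⟨u', hu'⟩ := exists_hierGauge_dist1_le_of_windows_level hjK hγ hγ1 hb hθσ a U' hU' i hi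
  refine ⟨fun x => (u x)⁻¹ * u' x, fun c hc => ?_⟩
  have h := dist1_relGauge_le _ _ u u' c (hu c hc) (hu' c hc)
  linarith

/-- ★★★ **THE TWO-FIELD SUP-CHART AT EVERY LEVEL, UNIFORM IN THE DEPTH, THE HEIGHT AND THE CUT-OFF.**  For every `L ≥ 2`, `b₀ > 0`, `p₀ > 0` and
`τ > 0` there is `γ₁ ∈ (0, 1]` such that for every member `F` with `F.L = L`, every `0 < γ ≤ γ₁`, every `K`, `j` with `j + 3 ≤ K`, every height
`i ≤ j + 1`, every level-`(j+1)` plaquette `a` and every two configurations `U, U'` with hStab's hierarchical windows around `a`, ONE gauge `g` of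
`T^{(i)}` gives `dist1 (((Ū^i U')^g) c · ((Ū^i U) c)⁻¹) ≤ τ` on every level-`i` bond with scaled corner within `8L^{j+1} + 3(L^i − 1)` of
`a₋·L^{j+1}`. [cite: Balaban1985Averaging, (64)-(68) p.29; Balaban1985UV3, (7) p.257] -/
theorem exists_gamma_relGauge_dist1_le_level (L : ℕ) (hL : 2 ≤ L) {b₀ p₀ : ℝ} (hb : 0 < b₀) (hp : 0 < p₀) {τ : ℝ} (hτ : 0 < τ) :
    ∃ γ₁ : ℝ, 0 < γ₁ ∧ γ₁ ≤ 1 ∧ ∀ (F : T3Family) (γ : ℝ), F.L = L → 0 < γ → γ ≤ γ₁ →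
      ∀ (K j : ℕ), j + 3 ≤ K → ∀ (i : ℕ), i ≤ j + 1 →
      ∀ (a : Plaq (F.P K) (j + 1)) (U U' : GaugeField (F.P K) 0 (Matrix.specialUnitaryGroup (Fin 2) ℂ)),
        (∀ (i : ℕ) (q : Plaq (F.P K) i), i < j + 1 → Site.tdist (fun k => ((((q.src k).val * F.L ^ i : ℕ)) : ZMod ((F.P K).sitesPerDir 0))) (fun k => ((((a.src k).val * F.L ^ (j + 1) : ℕ)) : ZMod ((F.P K).sitesPerDir 0))) + 64 * F.L ^ i ≤ 64 * F.L ^ (j + 1) → GaugeGroup.dist1 (GaugeField.plaqHol (Averaging.iter (fun i' => BlockAveraging.blockAvg (P := F.P K) (j := i') T3UnitLawDensityEML.ℰp) i U) q) < T3UnitScaleTilt.θBal F.L γ b₀ p₀ (K - i)) →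
        (∀ (i : ℕ) (q : Plaq (F.P K) i), i < j + 1 → Site.tdist (fun k => ((((q.src k).val * F.L ^ i : ℕ)) : ZMod ((F.P K).sitesPerDir 0))) (fun k => ((((a.src k).val * F.L ^ (j + 1) : ℕ)) : ZMod ((F.P K).sitesPerDir 0))) + 64 * F.L ^ i ≤ 64 * F.L ^ (j + 1) → GaugeGroup.dist1 (GaugeField.plaqHol (Averaging.iter (fun i' => BlockAveraging.blockAvg (P := F.P K) (j := i') T3UnitLawDensityEML.ℰp) i U') q) < T3UnitScaleTilt.θBal F.L γ b₀ p₀ (K - i)) →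
        ∃ g : GaugeTransf (F.P K) i (Matrix.specialUnitaryGroup (Fin 2) ℂ), ∀ c : PBond (F.P K) i,
          Site.tdist (fun k => ((((c.src k).val * F.L ^ i : ℕ)) : ZMod ((F.P K).sitesPerDir 0)))
              (fun k => ((((a.src k).val * F.L ^ (j + 1) : ℕ)) : ZMod ((F.P K).sitesPerDir 0))) ≤ 8 * F.L ^ (j + 1) + 3 * (F.L ^ i - 1) →
          dist1 (GaugeField.gaugeAct g (Averaging.iter (fun i' => BlockAveraging.blockAvg (P := F.P K) (j := i') T3UnitLawDensityEML.ℰp) i U') c *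
              (Averaging.iter (fun i' => BlockAveraging.blockAvg (P := F.P K) (j := i') T3UnitLawDensityEML.ℰp) i U c)⁻¹) ≤ τ := by
  obtain ⟨γa, hγa, hγa1, hθa⟩ := T3Thresholds.exists_gamma_forall_θBal_le (b₀ := b₀) (p₀ := p₀) hb hp
    (σ := 1 / (75 * ((L : ℝ) + 1) ^ 2)) (by positivity)
  set σ : ℝ := τ / (2 * (50 + 6644) * (L : ℝ) ^ 2) with hσ
  have hL0 : (0 : ℝ) < L := by exact_mod_cast (show 0 < L by omega)
  have hσ0 : 0 < σ := by rw [hσ]; positivity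
  obtain ⟨γs, hγs, hγs1, hθs⟩ := PoincareLipschitzThresholdSums.exists_gamma_forall_sum_θBal_le (b₀ := b₀) (p₀ := p₀) hb hp hσ0
  refine ⟨min γa γs, lt_min hγa hγs, (min_le_left _ _).trans hγa1, ?_⟩
  intro F γ hFL hγ hγ1 K j hjK i hi a U U' hU hU'
  subst hFL
  have hγa' : γ ≤ γa := hγ1.trans (min_le_left _ _)
  have hγs' : γ ≤ γs := hγ1.trans (min_le_right _ _)
  have hγone : γ ≤ 1 := hγa'.trans hγa1
  have hθσ : ∀ i', i' ≤ j → θBal F.L γ b₀ p₀ (K - i') ≤ 1 / (75 * ((F.L : ℝ) + 1) ^ 2) :=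
    fun i' _ => hθa F.L (by omega) γ hγ hγa' (K - i')
  obtain ⟨g, hg⟩ := exists_relGauge_dist1_le_of_windows_level hjK hγ hγone hb hθσ a U U' hU hU' i hi
  refine ⟨g, fun c hc => (hg c hc).trans ?_⟩
  have hsum : ∑ i' ∈ Finset.Ico i (j + 1), θBal F.L γ b₀ p₀ (K - i') ≤ σ := by
    have hsub : ∑ i' ∈ Finset.Ico i (j + 1), θBal F.L γ b₀ p₀ (K - i') ≤ ∑ i' ∈ Finset.range (j + 1), θBal F.L γ b₀ p₀ (K - i') := by
      refine Finset.sum_le_sum_of_subset_of_nonneg ?_ fun i' _ _ =>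
        (T3MinimiserStabilityReduction.θBal_pos (by omega) hγ hγone hb p₀ (K - i')).le
      intro x hx
      simp only [Finset.mem_Ico] at hx
      simp only [Finset.mem_range]
      exact hx.2
    refine hsub.trans ?_
    rw [sum_range_θBal_eq_sum_image (by omega)]
    exact hθs F.L hL γ hγ hγs' _
  have htop : θBal F.L γ b₀ p₀ (K - j) ≤ σ := by
    have h := hθs F.L hL γ hγ hγs' {K - j}
    rwa [Finset.sum_singleton] at h
  calc 2 * (50 * (F.L : ℝ) ^ 2 * (∑ i' ∈ Finset.Ico i (j + 1), θBal F.L γ b₀ p₀ (K - i')) + 6644 * (F.L : ℝ) ^ 2 * θBal F.L γ b₀ p₀ (K - j))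
      ≤ 2 * (50 * (F.L : ℝ) ^ 2 * σ + 6644 * (F.L : ℝ) ^ 2 * σ) := by
        have h1 := mul_le_mul_of_nonneg_left hsum (by positivity : (0 : ℝ) ≤ 50 * (F.L : ℝ) ^ 2)
        have h2 := mul_le_mul_of_nonneg_left htop (by positivity : (0 : ℝ) ≤ 6644 * (F.L : ℝ) ^ 2)
        linarith
    _ = τ := by rw [hσ]; field_simp

end Summit.QuantumFields.YangMills.Theorems.PoincareLipschitzHierAlignT3Level

end
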